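import Literature.NumberTheory.Automorphic.ArchLocalTorusNormalisedFamily         -- ★ p837324 (p02): per-place docking `exists_isQuotientOf_circleTorus` (+ ★ p837004, ★ p837127 transitively)
import Literature.NumberTheory.Automorphic.ArchTorusNormalisedFamily              -- ★ p837511 (p02): global docking `exists_isQuotientOf_archDiagTorus` (+ ★ p837122 `ArchDiagonalTorusCentralizer`)
import Literature.NumberTheory.Automorphic.LocalOrbitalIntegral                 -- ★ `orbitalIntegral`
import HarnessLib

/-!
# Harish-Chandra՚s torus orbital function on the FIXED quotient `G ⧸ T` for `U(σ_w diag α)(ℂ)` and `U(diag α)(L⁺ ⊗ ℝ)`, the torus-Haar input hygiene and the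
# regular-point bridge to `orbitalIntegral` (road D2′, «(V2′)»; Rogawski 1990 §1.7, §4.3, §4.9, §8.2–8.4)

Topic `NumberTheory/Automorphic`; namespaces `Literature.NumberTheory.Automorphic` (§0) and `….UnitaryGroup` (§§1–4).  THEOREMS ONLY (no `def`, no instance, no
notation, no axiom, no `sorry`).  Cell `pub/hodgecm-mathlib`, ENGINE T1 (crux H413 = `stmt-HodgeConjecture-24833`); floor-1 preparation, count-neutral, under books rows
#111 (S-d) ∕ #88 (ST-∞) (F0P3a-p02 (g8)'s CENSUS-D2prime-HClimit §4 gap (V2) «torus-normalised orbital integrals»; LEAD DESK WORD T6-93 (2) (a′), ruling (V7) T6-84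
«per place first»); author F0P3a-p06 (g9), over ★ `TorusNormalisedCentralizerMeasures` (p837127, generic), ★ `ArchLocalRegularCentralizer` (p837004, per place),
★ `ArchDiagonalTorusCentralizer` (p837122, global), ★ `ArchLocalTorusNormalisedFamily` (p837324, per-place docking); LEAD T6-99 (1) reshape.

WHAT.  Harish-Chandra's normalised orbital integral `z ↦ D(t(z))^{1∕2} Φ_{t(z)}(f)` along a compact Cartan `T` is a FUNCTION of `z` only when the orbit measures at all
regular `t(z)` are quotients of ONE Haar measure `ν` of `G` by ONE Haar measure `t_T` of `T` [Rogawski1990 §1.7 p. 6, §4.3 (4.3.1) p. 43; §8.2 p. 122 «`Φ_H(γ, f^H)`»,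
§8.4 p. 126].  The tree's currency indexes orbit measures by measures `t γ` on the centralisers `Z(γ)` (★ `OrbitalMeasureFamily.IsQuotientOf P ν t m`); ★ p837127 transports
`t_T` to every `Z(γ) = T`.  This file INSTANTIATES that at the two tori of road D1′b and adds the representative-free bridge:
* §0 (generic `G`) `quotientMeasure_congr_measure`; **`integral_descConj_quotientMeasure_congr`** — along an EQUALITY of subgroups `T = K` with `ρ = t_T ∘ (T = K)`, the
  `descConj`-integral over `G ⧸ K` against `dν ∕ dρ` equals the one over `G ⧸ T` against `dν ∕ dt_T`, for ANY Borel structures on the two quotients (`subst` + Borel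
  uniqueness); **`orbitalIntegral_eq_integral_descConj_of_eq_centralizer`** — the case `K = Z(γ)`: ★ `orbitalIntegral γ f (dν ∕ dρ)` = the integral over the FIXED
  quotient `G ⧸ T`.
* §1 PER PLACE INPUT HYGIENE (`G_w = archLocal L N (diagonal α) w = U(σ_w diag α)(ℂ)`, circle torus `T_w = (range circleDiagonal).subgroupOf G_w`): `mem_circleTorus_iff`,
  `coe_circleTorus_eq_range`, **`isCompact_circleTorus`**, `isClosed_circleTorus`, `circleTorus_comm`, `circleTorus_comm_circleDiagonal` (the torus centralises `diag z`
  for EVERY `z`), `isInvInvariant_of_isHaarMeasure_circleTorus`, **`isFiniteMeasure_of_isHaarMeasure_circleTorus`** (`0 < t_T(T_w) < ∞`, the mass normalisations divide by;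
  existence of `t_T` is Mathlib `Measure.haar`), **`isHaarMeasure_of_eq_map_circleTorus`** (the transported `ρ = t ⟨circleDiagonal N z, _⟩` of ★ p837324 is an
  inversion-invariant Haar measure on `Z(diag z)` — the instances ★ `quotientMeasure` wants).
* §2 PER PLACE, THE FIXED-QUOTIENT TORUS TERM `F_f(z) = ∫ y, descConj ⟨circleDiagonal N z, _⟩ T_w _ f y ∂(quotientMeasure T_w t_T _ ν)` at EVERY `z` (singular
  included): `descConj_circleDiagonal_mk` (integrand `g ↦ f(g · diag z · g⁻¹)`), `descConj_circleDiagonal_mk_mul` (torus-translation invariance).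
* §3 PER PLACE, THE REGULAR-POINT BRIDGE **`orbitalIntegral_circleDiagonal_eq_integral_descConj`**: for injective `z`, ★ `orbitalIntegral ⟨circleDiagonal N z, _⟩ f (dν ∕ dρ)`
  with `ρ = t_T.map (subgroupCongr (★ centralizer_circleDiagonal_eq_subgroupOf …).symm)` — ★ p837324's transport clause VERBATIM, so `ρ := t ⟨circleDiagonal N z, _⟩`
  for its family `t` — EQUALS `F_f(z)`.  (The per-place docking ∃ itself is ★ p837324 `exists_isQuotientOf_circleTorus`, imported, not restated.)
* §4 GLOBAL (`G_∞ = arch L⁺ L c N (diagonal α)`, torus `T_∞ = range (archDiagTorus L N α)`), the twin over ★ p837122 ∕ ★ p837511: `isCompact_coe_range_archDiagTorus`,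
  `isClosed_coe_range_archDiagTorus`, `range_archDiagTorus_comm(_apply)`, `isInvInvariant_of_isHaarMeasure_range_archDiagTorus`,
  **`isFiniteMeasure_of_isHaarMeasure_range_archDiagTorus`**, **`isHaarMeasure_of_eq_map_range_archDiagTorus`**, **`orbitalIntegral_archDiagTorus_eq_integral_descConj`**
  (the global bridge; the global docking ∃ is ★ p837511 `exists_isQuotientOf_archDiagTorus`, imported, not restated).
CAVEAT RECORDED (desk flag F0P3a-p06 (g9) 2026-08-31T23:14Z).  ★ `IsQuotientOf P ν t m` reads `P`, `t`, `m` at `Quotient.out c` only; with `P` = «regular torus point» (forced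
by the `hP : P γ → T = Z(γ)` shape) the docked `IsQuotientOf` binds only the classes whose chosen representative lies ON the torus.  Consumers wanting a FUNCTION of `z`
use the §0∕§1∕§2 bridge (the right-hand sides are defined for every `z` and mention no representative); consumers holding a Weil family of the thirteen-conjunct system
reach it through that system's (W) + (C) conjuncts (coherence of `t` under ★ `archStableCentralizerEquiv`).
HONEST LABEL: HC_CM is proved only modulo the printed citations until rung 0 closes; this file is measure-theoretic plumbing and pays nothing by itself.

## References
* [Rogawski1990] J. D. Rogawski, *Automorphic Representations of Unitary Groups in Three Variables*, Ann. of Math. Stud. 123 (1990): §1.7 p. 6 (Haar measures, compatible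
  measures), §3.1 p. 19, §4.3 (4.3.1) p. 43, §4.9 p. 54 (`Φ(γ, f)`), §8.2 p. 122, §8.4 pp. 126–127 (the torus `T`, `Φ_G(γ, f)` for `γ ∈ T`).
* [DeitmarEchterhoff2014] A. Deitmar, S. Echterhoff, *Principles of Harmonic Analysis*, 2nd ed. (2014), Thm. 1.5.3 (invariant quotient measures).
* [Folland1995] G. B. Folland, *A Course in Abstract Harmonic Analysis* (1995), Thm. 2.49 (abelian ⇒ unimodular).
* [BrockerTomDieck1985] Th. Bröcker, T. tom Dieck, *Representations of Compact Lie Groups*, GTM 98 (1985), IV (2.3)(i), (3.1).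
* [Knapp2002] A. W. Knapp, *Lie Groups Beyond an Introduction*, 2nd ed. (2002), VIII §2 (Haar measure).
* [BorelJacquet1979] A. Borel, H. Jacquet, PSPM 33.1 (1979), §4.1 (`G_∞`).
-/

set_option autoImplicit false

noncomputable section

open MeasureTheory Measure NumberField NumberField.InfinitePlace NumberField.mixedEmbedding
open Literature.MeasureTheory.Group
open scoped Matrix MatrixGroups

namespace Literature.NumberTheory.Automorphic

/-! ## §0 Generic: the quotient-measure orbital integrand along an EQUALITY of subgroups -/

section Generic

variable {G : Type*} [Group G] [TopologicalSpace G] [IsTopologicalGroup G] [LocallyCompactSpace G]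
  [SecondCountableTopology G] [T2Space G] [MeasurableSpace G] [BorelSpace G]

/-- ★ `quotientMeasure H ρ hH ν` depends on the measure `ρ` only (not on the proofs of its instance-properties). [cite: DeitmarEchterhoff2014, Thm. 1.5.3] -/
theorem quotientMeasure_congr_measure (H : Subgroup G) (hH : IsClosed (H : Set G))
    (ρ₁ ρ₂ : Measure H) [ρ₁.IsHaarMeasure] [ρ₁.IsInvInvariant] [ρ₂.IsHaarMeasure] [ρ₂.IsInvInvariant] (h : ρ₁ = ρ₂)
    (ν : Measure G) [IsFiniteMeasureOnCompacts ν] [ν.IsMulRightInvariant] [MeasurableSpace (G ⧸ H)] [BorelSpace (G ⧸ H)] :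
    quotientMeasure H ρ₁ hH ν = quotientMeasure H ρ₂ hH ν := by
  subst h
  rfl

/-- **THE BRIDGE ALONG `T = K`.**  For a subgroup `T` with Haar measure `t_T`, a subgroup `K = T` (typically `K = Z(γ)`, ★ `centralizer_circleDiagonal_eq_subgroupOf` ∕
★ `centralizer_archDiagTorus_eq_range`) carrying the TRANSPORTED measure `ρ = t_T ∘ (T = K)` (★ `exists_centralizerMeasures_eq_map_subgroupCongr`), and any element `γ`
centralised by `T`: the `descConj`-integral of `f` over `G ⧸ K` against `dν ∕ dρ` equals the one over the FIXED quotient `G ⧸ T` against `dν ∕ dt_T` — for ANY Borel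
structures on the two quotients.  (Representative-free: no `Quotient.out`.) [cite: DeitmarEchterhoff2014, Thm. 1.5.3] [cite: Rogawski1990, §1.7 p. 6; §4.3 (4.3.1) p. 43] -/
theorem integral_descConj_quotientMeasure_congr {E : Type*} [NormedAddCommGroup E] [NormedSpace ℝ E]
    (γ : G) {T K : Subgroup G} (h : T = K) (hT : ∀ m ∈ T, m * γ = γ * m) (hK : ∀ m ∈ K, m * γ = γ * m)
    (hTc : IsClosed (T : Set G)) (hKc : IsClosed (K : Set G))
    (tT : Measure T) [tT.IsHaarMeasure] [tT.IsInvInvariant] (ρ : Measure K) [ρ.IsHaarMeasure] [ρ.IsInvInvariant]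
    (hρ : ρ = tT.map (MulEquiv.subgroupCongr h))
    (ν : Measure G) [IsFiniteMeasureOnCompacts ν] [ν.IsMulRightInvariant]
    [iT : MeasurableSpace (G ⧸ T)] [bT : BorelSpace (G ⧸ T)] [iK : MeasurableSpace (G ⧸ K)] [bK : BorelSpace (G ⧸ K)]
    (f : G → E) :
    ∫ y, descConj γ K hK f y ∂(quotientMeasure K ρ hKc ν) = ∫ y, descConj γ T hT f y ∂(quotientMeasure T tT hTc ν) := by
  subst h
  have hi : iK = iT := by rw [@BorelSpace.measurable_eq _ _ iK bK, @BorelSpace.measurable_eq _ _ iT bT]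
  subst hi
  have hmap : tT.map (MulEquiv.subgroupCongr (rfl : T = T)) = tT := by
    have hid : ⇑(MulEquiv.subgroupCongr (rfl : T = T)) = id := funext fun x => rfl
    rw [hid, Measure.map_id]
  rw [hmap] at hρ
  rw [quotientMeasure_congr_measure T hKc ρ tT hρ ν]

/-- The same bridge for ★ `orbitalIntegral γ f (dν ∕ dρ)` (whose quotient is `G ⧸ Z(γ)`): it equals the `descConj`-integral over `G ⧸ T` against `dν ∕ dt_T` whenever
`T = Z(γ)` and `ρ = t_T ∘ (T = Z(γ))`. [cite: Rogawski1990, §4.9 p. 54; §1.7 p. 6] [cite: DeitmarEchterhoff2014, Thm. 1.5.3] -/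
theorem orbitalIntegral_eq_integral_descConj_of_eq_centralizer {E : Type*} [NormedAddCommGroup E] [NormedSpace ℝ E]
    (γ : G) {T : Subgroup G} (h : T = Subgroup.centralizer ({γ} : Set G)) (hT : ∀ m ∈ T, m * γ = γ * m) (hTc : IsClosed (T : Set G))
    (tT : Measure T) [tT.IsHaarMeasure] [tT.IsInvInvariant]
    (ρ : Measure (Subgroup.centralizer ({γ} : Set G))) [ρ.IsHaarMeasure] [ρ.IsInvInvariant] (hρ : ρ = tT.map (MulEquiv.subgroupCongr h))
    (ν : Measure G) [IsFiniteMeasureOnCompacts ν] [ν.IsMulRightInvariant]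
    [MeasurableSpace (G ⧸ T)] [BorelSpace (G ⧸ T)]
    [MeasurableSpace (G ⧸ Subgroup.centralizer ({γ} : Set G))] [BorelSpace (G ⧸ Subgroup.centralizer ({γ} : Set G))] (f : G → E) :
    orbitalIntegral γ f (quotientMeasure (Subgroup.centralizer ({γ} : Set G)) ρ (isClosed_coe_centralizer_singleton γ) ν) =
      ∫ y, descConj γ T hT f y ∂(quotientMeasure T tT hTc ν) :=
  integral_descConj_quotientMeasure_congr γ h hT _ hTc _ tT ρ hρ ν f

end Generic

namespace UnitaryGroup

/-! ## §1 PER PLACE: the circle torus `T_w = diag((S¹)^N) ≤ G_w = U(σ_w diag α)(ℂ)` -/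

section Place

variable (L : Type) [Field L] (N : ℕ) (α : Fin N → L) (w : {w : InfinitePlace L // IsComplex w})

/-- Membership in the circle torus `T_w = (range circleDiagonal) ⊓ G_w` of `G_w = U(σ_w diag α)(ℂ)`: `g ∈ T_w ↔ ∃ z, diag(z) = g`. [cite: BrockerTomDieck1985, IV (3.1) (p0160)] -/
theorem mem_circleTorus_iff (g : archLocal L N (Matrix.diagonal α) w) :
    g ∈ (circleDiagonal N).range.subgroupOf (archLocal L N (Matrix.diagonal α) w) ↔
      ∃ z : Fin N → Circle, (⟨circleDiagonal N z, circleDiagonal_mem_archLocal_diagonal L N α w z⟩ : archLocal L N (Matrix.diagonal α) w) = g := by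
  rw [Subgroup.mem_subgroupOf, MonoidHom.mem_range]
  exact ⟨fun ⟨z, hz⟩ => ⟨z, Subtype.ext hz⟩, fun ⟨z, hz⟩ => ⟨z, congrArg Subtype.val hz⟩⟩

/-- The circle torus as a SET is the range of the continuous map `z ↦ diag(z)`. [cite: BrockerTomDieck1985, IV (3.1) (p0160)] -/
theorem coe_circleTorus_eq_range :
    (((circleDiagonal N).range.subgroupOf (archLocal L N (Matrix.diagonal α) w) : Subgroup (archLocal L N (Matrix.diagonal α) w)) :
        Set (archLocal L N (Matrix.diagonal α) w)) =
      Set.range fun z : Fin N → Circle =>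
        (⟨circleDiagonal N z, circleDiagonal_mem_archLocal_diagonal L N α w z⟩ : archLocal L N (Matrix.diagonal α) w) := by
  ext g
  rw [SetLike.mem_coe, mem_circleTorus_iff, Set.mem_range]

/-- **The circle torus `T_w` is compact** (continuous image of `(S¹)^N`). [cite: BrockerTomDieck1985, IV (3.1) (p0160)] -/
theorem isCompact_circleTorus :
    IsCompact (((circleDiagonal N).range.subgroupOf (archLocal L N (Matrix.diagonal α) w) : Subgroup (archLocal L N (Matrix.diagonal α) w)) :
      Set (archLocal L N (Matrix.diagonal α) w)) := by
  rw [coe_circleTorus_eq_range]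
  exact isCompact_range ((continuous_circleDiagonal N).subtype_mk _)

/-- The circle torus is closed in `G_w`. [cite: BrockerTomDieck1985, IV (3.1) (p0160)] -/
theorem isClosed_circleTorus :
    IsClosed (((circleDiagonal N).range.subgroupOf (archLocal L N (Matrix.diagonal α) w) : Subgroup (archLocal L N (Matrix.diagonal α) w)) :
      Set (archLocal L N (Matrix.diagonal α) w)) :=
  (isCompact_circleTorus L N α w).isClosed

/-- The circle torus is commutative. [cite: BrockerTomDieck1985, IV (3.1) (p0160)] -/
theorem circleTorus_comm :
    ∀ a ∈ (circleDiagonal N).range.subgroupOf (archLocal L N (Matrix.diagonal α) w),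
      ∀ b ∈ (circleDiagonal N).range.subgroupOf (archLocal L N (Matrix.diagonal α) w), a * b = b * a :=
  fun _ ha _ hb => mul_comm_of_mem_range_circleDiagonal L N α w (Subgroup.mem_subgroupOf.mp ha) (Subgroup.mem_subgroupOf.mp hb)

/-- Every element of the circle torus centralises `diag(z)` (ALL `z`, singular included) — the hypothesis of ★ `descConj` on the fixed quotient `G_w ⧸ T_w`.
[cite: BrockerTomDieck1985, IV (3.1) (p0160)] -/
theorem circleTorus_comm_circleDiagonal (z : Fin N → Circle) :
    ∀ m ∈ (circleDiagonal N).range.subgroupOf (archLocal L N (Matrix.diagonal α) w),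
      m * (⟨circleDiagonal N z, circleDiagonal_mem_archLocal_diagonal L N α w z⟩ : archLocal L N (Matrix.diagonal α) w) =
        (⟨circleDiagonal N z, circleDiagonal_mem_archLocal_diagonal L N α w z⟩ : archLocal L N (Matrix.diagonal α) w) * m :=
  fun m hm => circleTorus_comm L N α w m hm _ ((mem_circleTorus_iff L N α w _).mpr ⟨z, rfl⟩)

/-- **INPUT HYGIENE: every Haar measure `t_T` on the (compact) circle torus is FINITE with `0 < t_T(T_w) < ∞`** — the mass the torus normalisations divide by
(existence of `t_T` itself is Mathlib `MeasureTheory.Measure.haar`). [cite: Rogawski1990, §1.7 p. 6] [cite: Knapp2002, VIII.§2 Cor. 8.31] -/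
theorem isFiniteMeasure_of_isHaarMeasure_circleTorus
    [MeasurableSpace (archLocal L N (Matrix.diagonal α) w)] [BorelSpace (archLocal L N (Matrix.diagonal α) w)]
    (tT : Measure ((circleDiagonal N).range.subgroupOf (archLocal L N (Matrix.diagonal α) w))) [tT.IsHaarMeasure] :
    IsFiniteMeasure tT ∧ 0 < tT Set.univ := by
  haveI : CompactSpace ((circleDiagonal N).range.subgroupOf (archLocal L N (Matrix.diagonal α) w)) :=
    isCompact_iff_compactSpace.mp (isCompact_circleTorus L N α w)
  exact ⟨CompactSpace.isFiniteMeasure, isOpen_univ.measure_pos tT Set.univ_nonempty⟩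

/-- **The transported measure at a regular torus point is an inversion-invariant Haar measure** on `Z(diag z)`: for `ρ = t_T ∘ (Z(diag z) = T_w)⁻¹` — the value
`t ⟨circleDiagonal N z, _⟩` of ★ `exists_isQuotientOf_circleTorus`'s family (p837324, its transport clause, same orientation) — `ρ` is Haar (★ `isHaarMeasure_map_subgroupCongr`)
and inversion-invariant (`Z(diag z)` is commutative, ★ `centralizer_circleDiagonal_mul_comm`). These are the instances ★ `quotientMeasure` wants. [cite: Folland1995, Thm. 2.49]
[cite: DeitmarEchterhoff2014, Thm. 1.5.3] -/
theorem isHaarMeasure_of_eq_map_circleTorus (hα : ∀ i, α i ≠ 0)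
    [LocallyCompactSpace (archLocal L N (Matrix.diagonal α) w)] [SecondCountableTopology (archLocal L N (Matrix.diagonal α) w)]
    [MeasurableSpace (archLocal L N (Matrix.diagonal α) w)] [BorelSpace (archLocal L N (Matrix.diagonal α) w)]
    (tT : Measure ((circleDiagonal N).range.subgroupOf (archLocal L N (Matrix.diagonal α) w))) [tT.IsHaarMeasure]
    {z : Fin N → Circle} (hz : Function.Injective z)
    (ρ : Measure (Subgroup.centralizer
      ({(⟨circleDiagonal N z, circleDiagonal_mem_archLocal_diagonal L N α w z⟩ : archLocal L N (Matrix.diagonal α) w)} :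
        Set (archLocal L N (Matrix.diagonal α) w))))
    (hρ : ρ = tT.map (MulEquiv.subgroupCongr (centralizer_circleDiagonal_eq_subgroupOf L N α w hα hz).symm)) :
    ρ.IsHaarMeasure ∧ ρ.IsInvInvariant := by
  subst hρ
  haveI hH := isHaarMeasure_map_subgroupCongr (centralizer_circleDiagonal_eq_subgroupOf L N α w hα hz).symm tT
  haveI : (tT.map (MulEquiv.subgroupCongr (centralizer_circleDiagonal_eq_subgroupOf L N α w hα hz).symm)).IsMulRightInvariant :=
    isMulRightInvariant_of_forall_comm _ (isClosed_coe_centralizer_singleton _)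
      (fun a ha b hb => congrArg Subtype.val (centralizer_circleDiagonal_mul_comm L N α w hα hz ⟨a, ha⟩ ⟨b, hb⟩)) _
  exact ⟨hH, isInvInvariant_of_isMulRightInvariant_of_isClosed _ (isClosed_coe_centralizer_singleton _) _⟩

/-! ## §2 PER PLACE: Harish-Chandra's torus function on the FIXED quotient `G_w ⧸ T_w` — defined at EVERY `z` -/

/-- **THE FIXED-QUOTIENT TORUS TERM.**  For EVERY `z ∈ (S¹)^N` (regular or not), a right-invariant `ν` on `G_w` and a Haar `t_T` on `T_w`, the integrand of
`F_f(z) := ∫ y, descConj (diag z) T_w _ f y ∂(dν ∕ dt_T)` on `G_w ⧸ T_w` is `g T_w ↦ f(g · diag z · g⁻¹)` (★ `descConj_mk`; well defined because the abelian torus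
centralises `diag z`).  This is the function of `z` whose `D^{1∕2}`-multiple Harish-Chandra's limit formulas differentiate; it mentions no orbit-class representative.
[cite: Rogawski1990, §8.2 p. 122; §8.4 p. 126; §4.9 p. 54] -/
theorem descConj_circleDiagonal_mk {E : Type*} (z : Fin N → Circle) (f : archLocal L N (Matrix.diagonal α) w → E) (g : archLocal L N (Matrix.diagonal α) w) :
    descConj (⟨circleDiagonal N z, circleDiagonal_mem_archLocal_diagonal L N α w z⟩ : archLocal L N (Matrix.diagonal α) w)
        ((circleDiagonal N).range.subgroupOf (archLocal L N (Matrix.diagonal α) w)) (circleTorus_comm_circleDiagonal L N α w z) f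
        (QuotientGroup.mk g : archLocal L N (Matrix.diagonal α) w ⧸ (circleDiagonal N).range.subgroupOf (archLocal L N (Matrix.diagonal α) w)) =
      f (g * ⟨circleDiagonal N z, circleDiagonal_mem_archLocal_diagonal L N α w z⟩ * g⁻¹) :=
  rfl

/-- The fixed-quotient torus term along the torus itself: translating the representative by a torus element does not change the integrand (`T_w` abelian).
[cite: Rogawski1990, §8.2 p. 122] [cite: BrockerTomDieck1985, IV (3.1) (p0160)] -/
theorem descConj_circleDiagonal_mk_mul {E : Type*} (z : Fin N → Circle) (f : archLocal L N (Matrix.diagonal α) w → E) (g : archLocal L N (Matrix.diagonal α) w)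
    {m : archLocal L N (Matrix.diagonal α) w} (hm : m ∈ (circleDiagonal N).range.subgroupOf (archLocal L N (Matrix.diagonal α) w)) :
    descConj (⟨circleDiagonal N z, circleDiagonal_mem_archLocal_diagonal L N α w z⟩ : archLocal L N (Matrix.diagonal α) w)
        ((circleDiagonal N).range.subgroupOf (archLocal L N (Matrix.diagonal α) w)) (circleTorus_comm_circleDiagonal L N α w z) f
        (QuotientGroup.mk (g * m)) =
      descConj (⟨circleDiagonal N z, circleDiagonal_mem_archLocal_diagonal L N α w z⟩ : archLocal L N (Matrix.diagonal α) w)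
        ((circleDiagonal N).range.subgroupOf (archLocal L N (Matrix.diagonal α) w)) (circleTorus_comm_circleDiagonal L N α w z) f
        (QuotientGroup.mk g) := by
  congr 1
  exact (QuotientGroup.eq.mpr (by rw [inv_mul_cancel_left]; exact hm)).symm

/-! ## §3 PER PLACE: the REGULAR-POINT BRIDGE to ★ `orbitalIntegral` at `Z(diag z)` -/

/-- **THE REGULAR-POINT BRIDGE, PER PLACE**: for a REGULAR `z` and the transported measure `ρ = t_T ∘ (Z(diag z) = T_w)⁻¹` on the centraliser — i.e. `ρ := t ⟨circleDiagonal N z, _⟩`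
for the family `t` of ★ `exists_isQuotientOf_circleTorus` (p837324; `hρ` is its transport clause verbatim, instances by `isHaarMeasure_of_eq_map_circleTorus`) —
`Φ_{diag z}(f) := orbitalIntegral (diag z) f (dν ∕ dρ)` (★ `orbitalIntegral`, quotient `G_w ⧸ Z(diag z)`) EQUALS the integral of `y ↦ f(y · diag z · y⁻¹)` over the FIXED quotient
`G_w ⧸ T_w` against `dν ∕ dt_T` — the function of `z` that the limit formulas differentiate (defined by the right-hand side for EVERY `z`, regular or not).
[cite: Rogawski1990, §4.9 p. 54; §8.2 p. 122; §1.7 p. 6] [cite: DeitmarEchterhoff2014, Thm. 1.5.3] -/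
theorem orbitalIntegral_circleDiagonal_eq_integral_descConj {E : Type*} [NormedAddCommGroup E] [NormedSpace ℝ E] (hα : ∀ i, α i ≠ 0)
    [LocallyCompactSpace (archLocal L N (Matrix.diagonal α) w)] [SecondCountableTopology (archLocal L N (Matrix.diagonal α) w)]
    [MeasurableSpace (archLocal L N (Matrix.diagonal α) w)] [BorelSpace (archLocal L N (Matrix.diagonal α) w)]
    (ν : Measure (archLocal L N (Matrix.diagonal α) w)) [IsFiniteMeasureOnCompacts ν] [ν.IsMulRightInvariant]
    (tT : Measure ((circleDiagonal N).range.subgroupOf (archLocal L N (Matrix.diagonal α) w))) [tT.IsHaarMeasure] [tT.IsInvInvariant]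
    {z : Fin N → Circle} (hz : Function.Injective z)
    (ρ : Measure (Subgroup.centralizer
      ({(⟨circleDiagonal N z, circleDiagonal_mem_archLocal_diagonal L N α w z⟩ : archLocal L N (Matrix.diagonal α) w)} :
        Set (archLocal L N (Matrix.diagonal α) w))))
    [ρ.IsHaarMeasure] [ρ.IsInvInvariant]
    (hρ : ρ = tT.map (MulEquiv.subgroupCongr (centralizer_circleDiagonal_eq_subgroupOf L N α w hα hz).symm))
    [MeasurableSpace (archLocal L N (Matrix.diagonal α) w ⧸ (circleDiagonal N).range.subgroupOf (archLocal L N (Matrix.diagonal α) w))]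
    [BorelSpace (archLocal L N (Matrix.diagonal α) w ⧸ (circleDiagonal N).range.subgroupOf (archLocal L N (Matrix.diagonal α) w))]
    [MeasurableSpace (archLocal L N (Matrix.diagonal α) w ⧸ Subgroup.centralizer
      ({(⟨circleDiagonal N z, circleDiagonal_mem_archLocal_diagonal L N α w z⟩ : archLocal L N (Matrix.diagonal α) w)} :
        Set (archLocal L N (Matrix.diagonal α) w)))]
    [BorelSpace (archLocal L N (Matrix.diagonal α) w ⧸ Subgroup.centralizer
      ({(⟨circleDiagonal N z, circleDiagonal_mem_archLocal_diagonal L N α w z⟩ : archLocal L N (Matrix.diagonal α) w)} :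
        Set (archLocal L N (Matrix.diagonal α) w)))]
    (f : archLocal L N (Matrix.diagonal α) w → E) :
    orbitalIntegral (⟨circleDiagonal N z, circleDiagonal_mem_archLocal_diagonal L N α w z⟩ : archLocal L N (Matrix.diagonal α) w) f
        (quotientMeasure _ ρ (isClosed_coe_centralizer_singleton _) ν) =
      ∫ y, descConj (⟨circleDiagonal N z, circleDiagonal_mem_archLocal_diagonal L N α w z⟩ : archLocal L N (Matrix.diagonal α) w)
          ((circleDiagonal N).range.subgroupOf (archLocal L N (Matrix.diagonal α) w)) (circleTorus_comm_circleDiagonal L N α w z) f y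
        ∂(quotientMeasure _ tT (isClosed_circleTorus L N α w) ν) := by
  exact orbitalIntegral_eq_integral_descConj_of_eq_centralizer _ (centralizer_circleDiagonal_eq_subgroupOf L N α w hα hz).symm
    (circleTorus_comm_circleDiagonal L N α w z) (isClosed_circleTorus L N α w) tT ρ hρ ν f

end Place

/-! ## §4 GLOBAL: the diagonal torus `T_∞ = range (archDiagTorus L N α) ≤ G_∞ = U(diag α)(L⁺ ⊗ ℝ)` -/

section Global

variable (L : Type) [Field L] [NumberField L] [IsCMField L] (N : ℕ) (α : Fin N → L)

/-- The global torus is compact (★ `isCompact_range_archDiagTorus`). [cite: BrockerTomDieck1985, IV (3.1) (p0160)] [cite: BorelJacquet1979, §4.1] -/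
theorem isCompact_coe_range_archDiagTorus :
    IsCompact (((archDiagTorus L N α).range : Subgroup (arch (↥(maximalRealSubfield L)) L (IsCMField.complexConj L) N (Matrix.diagonal α))) :
      Set (arch (↥(maximalRealSubfield L)) L (IsCMField.complexConj L) N (Matrix.diagonal α))) := by
  rw [MonoidHom.coe_range]
  exact isCompact_range_archDiagTorus L N α

/-- The global torus is closed in `G_∞`. [cite: BrockerTomDieck1985, IV (3.1) (p0160)] -/
theorem isClosed_coe_range_archDiagTorus :
    IsClosed (((archDiagTorus L N α).range : Subgroup (arch (↥(maximalRealSubfield L)) L (IsCMField.complexConj L) N (Matrix.diagonal α))) :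
      Set (arch (↥(maximalRealSubfield L)) L (IsCMField.complexConj L) N (Matrix.diagonal α))) :=
  (isCompact_coe_range_archDiagTorus L N α).isClosed

/-- The global torus is commutative (★ `archDiagTorus_mul_comm`). [cite: BrockerTomDieck1985, IV (3.1) (p0160)] -/
theorem range_archDiagTorus_comm :
    ∀ a ∈ (archDiagTorus L N α).range, ∀ b ∈ (archDiagTorus L N α).range, a * b = b * a := by
  rintro _ ⟨z, rfl⟩ _ ⟨z', rfl⟩
  exact archDiagTorus_mul_comm L N α z z'

/-- Every torus element centralises `t(z)` (ALL `z`) — the hypothesis of ★ `descConj` on the fixed quotient `G_∞ ⧸ T_∞`. [cite: BrockerTomDieck1985, IV (3.1) (p0160)] -/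
theorem range_archDiagTorus_comm_apply (z : {w : InfinitePlace L // IsComplex w} → Fin N → Circle) :
    ∀ m ∈ (archDiagTorus L N α).range, m * archDiagTorus L N α z = archDiagTorus L N α z * m :=
  fun m hm => range_archDiagTorus_comm L N α m hm _ ⟨z, rfl⟩

/-- Every Haar measure on the global torus is right- and inversion-invariant (abelian). [cite: Folland1995, Thm. 2.49] -/
theorem isInvInvariant_of_isHaarMeasure_range_archDiagTorus
    [MeasurableSpace (arch (↥(maximalRealSubfield L)) L (IsCMField.complexConj L) N (Matrix.diagonal α))]
    [BorelSpace (arch (↥(maximalRealSubfield L)) L (IsCMField.complexConj L) N (Matrix.diagonal α))]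
    (tT : Measure (archDiagTorus L N α).range) [tT.IsHaarMeasure] : tT.IsMulRightInvariant ∧ tT.IsInvInvariant := by
  haveI : tT.IsMulRightInvariant :=
    isMulRightInvariant_of_forall_comm _ (isClosed_coe_range_archDiagTorus L N α) (range_archDiagTorus_comm L N α) tT
  exact ⟨this, isInvInvariant_of_isMulRightInvariant_of_isClosed _ (isClosed_coe_range_archDiagTorus L N α) tT⟩

/-- **INPUT HYGIENE (global)**: every Haar measure on the compact torus `T_∞` is finite with `0 < t_T(T_∞)`. [cite: Rogawski1990, §1.7 p. 6] [cite: Knapp2002, VIII.§2 Cor. 8.31] -/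
theorem isFiniteMeasure_of_isHaarMeasure_range_archDiagTorus
    [MeasurableSpace (arch (↥(maximalRealSubfield L)) L (IsCMField.complexConj L) N (Matrix.diagonal α))]
    [BorelSpace (arch (↥(maximalRealSubfield L)) L (IsCMField.complexConj L) N (Matrix.diagonal α))]
    (tT : Measure (archDiagTorus L N α).range) [tT.IsHaarMeasure] : IsFiniteMeasure tT ∧ 0 < tT Set.univ := by
  haveI : CompactSpace (archDiagTorus L N α).range := isCompact_iff_compactSpace.mp (isCompact_coe_range_archDiagTorus L N α)
  exact ⟨CompactSpace.isFiniteMeasure, isOpen_univ.measure_pos tT Set.univ_nonempty⟩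

/-- **The transported measure at a regular global torus point is an inversion-invariant Haar measure** on `Z(t z)`: `ρ = t_T ∘ (Z(t z) = T_∞)⁻¹` — the value
`t (archDiagTorus L N α z)` of ★ `exists_isQuotientOf_archDiagTorus`'s family (p837511, same orientation). [cite: Folland1995, Thm. 2.49] [cite: DeitmarEchterhoff2014, Thm. 1.5.3] -/
theorem isHaarMeasure_of_eq_map_range_archDiagTorus (hα : ∀ i, α i ≠ 0)
    [MeasurableSpace (arch (↥(maximalRealSubfield L)) L (IsCMField.complexConj L) N (Matrix.diagonal α))]
    [BorelSpace (arch (↥(maximalRealSubfield L)) L (IsCMField.complexConj L) N (Matrix.diagonal α))]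
    (tT : Measure (archDiagTorus L N α).range) [tT.IsHaarMeasure]
    {z : {w : InfinitePlace L // IsComplex w} → Fin N → Circle} (hz : ∀ w, Function.Injective (z w))
    (ρ : Measure (Subgroup.centralizer ({archDiagTorus L N α z} : Set (arch (↥(maximalRealSubfield L)) L (IsCMField.complexConj L) N (Matrix.diagonal α)))))
    (hρ : ρ = tT.map (MulEquiv.subgroupCongr (centralizer_archDiagTorus_eq_range L N α hα hz).symm)) :
    ρ.IsHaarMeasure ∧ ρ.IsInvInvariant := by
  subst hρ
  haveI hH := isHaarMeasure_map_subgroupCongr (centralizer_archDiagTorus_eq_range L N α hα hz).symm tT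
  haveI : (tT.map (MulEquiv.subgroupCongr (centralizer_archDiagTorus_eq_range L N α hα hz).symm)).IsMulRightInvariant :=
    isMulRightInvariant_of_forall_comm _ (isClosed_coe_centralizer_singleton _) (fun a ha b hb => by
      rw [centralizer_archDiagTorus_eq_range L N α hα hz] at ha hb
      exact range_archDiagTorus_comm L N α a ha b hb) _
  exact ⟨hH, isInvInvariant_of_isMulRightInvariant_of_isClosed _ (isClosed_coe_centralizer_singleton _) _⟩

/-- **THE REGULAR-POINT BRIDGE ON `G_∞`, REPRESENTATIVE-FREE**: for REGULAR `z` and the transported measure `ρ = t_T ∘ (T_∞ = Z(t z))`,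
(`ρ := t (archDiagTorus L N α z)` of ★ p837511's family, `hρ` = its transport clause verbatim) `orbitalIntegral (t z) f (dν ∕ dρ)` equals the integral of `y ↦ f(y · t(z) · y⁻¹)` over the
FIXED quotient `G_∞ ⧸ T_∞` against `dν ∕ dt_T` — defined by the right-hand side for
EVERY `z`; the function the limit formulas of ROAD-Sd §2 differentiate in the angles of `z`. [cite: Rogawski1990, §4.9 p. 54; §8.4 pp. 126–127; §1.7 p. 6]
[cite: DeitmarEchterhoff2014, Thm. 1.5.3] -/
theorem orbitalIntegral_archDiagTorus_eq_integral_descConj {E : Type*} [NormedAddCommGroup E] [NormedSpace ℝ E] (hα : ∀ i, α i ≠ 0)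
    [MeasurableSpace (arch (↥(maximalRealSubfield L)) L (IsCMField.complexConj L) N (Matrix.diagonal α))]
    [BorelSpace (arch (↥(maximalRealSubfield L)) L (IsCMField.complexConj L) N (Matrix.diagonal α))]
    (ν : Measure (arch (↥(maximalRealSubfield L)) L (IsCMField.complexConj L) N (Matrix.diagonal α))) [IsFiniteMeasureOnCompacts ν]
    [ν.IsMulRightInvariant] (tT : Measure (archDiagTorus L N α).range) [tT.IsHaarMeasure] [tT.IsInvInvariant]
    {z : {w : InfinitePlace L // IsComplex w} → Fin N → Circle} (hz : ∀ w, Function.Injective (z w))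
    (ρ : Measure (Subgroup.centralizer ({archDiagTorus L N α z} : Set (arch (↥(maximalRealSubfield L)) L (IsCMField.complexConj L) N (Matrix.diagonal α)))))
    [ρ.IsHaarMeasure] [ρ.IsInvInvariant]
    (hρ : ρ = tT.map (MulEquiv.subgroupCongr (centralizer_archDiagTorus_eq_range L N α hα hz).symm))
    [MeasurableSpace (arch (↥(maximalRealSubfield L)) L (IsCMField.complexConj L) N (Matrix.diagonal α) ⧸ (archDiagTorus L N α).range)]
    [BorelSpace (arch (↥(maximalRealSubfield L)) L (IsCMField.complexConj L) N (Matrix.diagonal α) ⧸ (archDiagTorus L N α).range)]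
    [MeasurableSpace (arch (↥(maximalRealSubfield L)) L (IsCMField.complexConj L) N (Matrix.diagonal α) ⧸
      Subgroup.centralizer ({archDiagTorus L N α z} : Set (arch (↥(maximalRealSubfield L)) L (IsCMField.complexConj L) N (Matrix.diagonal α))))]
    [BorelSpace (arch (↥(maximalRealSubfield L)) L (IsCMField.complexConj L) N (Matrix.diagonal α) ⧸
      Subgroup.centralizer ({archDiagTorus L N α z} : Set (arch (↥(maximalRealSubfield L)) L (IsCMField.complexConj L) N (Matrix.diagonal α))))]
    (f : arch (↥(maximalRealSubfield L)) L (IsCMField.complexConj L) N (Matrix.diagonal α) → E) :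
    orbitalIntegral (archDiagTorus L N α z) f (quotientMeasure _ ρ (isClosed_coe_centralizer_singleton _) ν) =
      ∫ y, descConj (archDiagTorus L N α z) (archDiagTorus L N α).range (range_archDiagTorus_comm_apply L N α z) f y
        ∂(quotientMeasure _ tT (isClosed_coe_range_archDiagTorus L N α) ν) :=
  orbitalIntegral_eq_integral_descConj_of_eq_centralizer _ (centralizer_archDiagTorus_eq_range L N α hα hz).symm
    (range_archDiagTorus_comm_apply L N α z) (isClosed_coe_range_archDiagTorus L N α) tT ρ hρ ν f

end Global

end UnitaryGroup

end Literature.NumberTheory.Automorphic
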